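import Mathlib
import Literature.NumberTheory.Sieve.RoughOmegaCellsAsymptoticDensity
import Literature.NumberTheory.Sieve.BombieriAsymptoticSieveMertens
import Summits.Parity.GeneralizedHardyLittlewood.Theorems.ParityLeakOneFifthPlainSplitTwistedCellSieve
import Summits.Parity.GeneralizedHardyLittlewood.Theorems.ParityLeakOneFifthPlainSplitRoughMass
import Summits.Parity.GeneralizedHardyLittlewood.Theorems.ParityLeakOneFifthPlainSplitCalibReduction
import Summits.Parity.GeneralizedHardyLittlewood.Theorems.ParityLeakOneFifthParityLeakSieveCornerSum
import HarnessLib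

/-!
# Route ParityLeakOneFifth, crux `ParityLeakSieve` (stmt-Parity-18381), skeleton `birth`:
# the error cells of the host side of stub S1

The pointwise lower-bound sieve `G(m) ≤ 1[m prime] + 1[D < P⁻(m), Ω(m) = 2] + 32·1[Ω(m) = 5]
+ 32·1[m not squarefree]` (file `…Census.lean`) is summed against the host `a(n) = log n·1[n prime]`
on `m = n + 2`, `n ∈ (x, 2x]`.  This file bounds the three error sums by `δ x/log x`
(`host_err_le`): the boundary `Ω = 2` cell above `D = x^{1/2−2ε}` (density `I₂(u) ≤ 12ε`) and the
cell `Ω = 5` of the `y = x^{1/5}`-rough integers (density `I₅(u) → 0` as `u → 5⁺`) through the sieve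
step `twistedCell_sieve_le` at `z' = x^{1/10}` (the primes `n > x` are `z'`-rough; `V_sh(z') ≤ 20/log x`)
with Alladi's asymptotics, and the non-squarefree shifts trivially (`card_nonSquarefree_rough_le`).
-/

namespace Summit.Parity.GeneralizedHardyLittlewood.Theorems.ParityLeakOneFifth

open Finset Real
open scoped ArithmeticFunction.Omega
open Literature.NumberTheory.Sieve

/-- `V_sh(w) ≤ 2/log w` for `w > 2` (`V_sh ≤ 2V` and the Mertens-type bound `V(w) ≤ 1/log w`). -/
theorem Vsh_le_div_log {w : ℝ} (hw : 2 < w) :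
    ∏ p ∈ (Finset.range ⌈w⌉₊).filter (fun p : ℕ => p.Prime ∧ p ≠ 2), (1 - 1 / ((p : ℝ) - 1)) ≤
      2 / Real.log w := by
  refine (Vsh_le_two_mul_V hw).trans ?_
  have hPB : Nat.primesBelow ⌈w⌉₊ = (Finset.range ⌈w⌉₊).filter Nat.Prime := rfl
  have h := BombieriSieve.prod_primesBelow_one_sub_inv_le (z := w) (by linarith)
  rw [hPB] at h
  simp only [one_div] at h ⊢
  have e : ∏ p ∈ (Finset.range ⌈w⌉₊).filter Nat.Prime, (1 - ((p : ℕ) : ℝ)⁻¹) =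
      ∏ p ∈ (Finset.range ⌈w⌉₊).filter Nat.Prime, (1 - ((p : ℕ) : ℝ)⁻¹) := rfl
  calc 2 * ∏ p ∈ (Finset.range ⌈w⌉₊).filter Nat.Prime, (1 - ((p : ℝ))⁻¹) ≤ 2 * (Real.log w)⁻¹ :=
        mul_le_mul_of_nonneg_left h (by norm_num)
    _ = 2 / Real.log w := by rw [div_eq_mul_inv]

/-- A prime `n > w` is `w`-rough. -/
theorem rough_of_prime {n : ℕ} (hn : n.Prime) {w : ℝ} (hw : w ≤ (n : ℝ)) :
    ∀ p ∈ n.primeFactors, w ≤ (p : ℝ) := by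
  intro p hp
  rw [Nat.Prime.primeFactors hn, Finset.mem_singleton] at hp
  rw [hp]; exact hw

/-- The arithmetic of `strip_count_le` over real variables. -/
theorem strip_arith {B c2 c1 Vsh C₁ E main errA ε x ℓ CA C₂ : ℝ}
    (hB : B ≤ (c2 - c1) * Vsh * (1 + C₁ * Real.exp (-1)) + E)
    (hA : c2 - main ≤ errA) (hmain : main ≤ 48 * ε * x / ℓ) (herrA : errA ≤ 25 * CA * x / ℓ ^ 2)
    (hc1 : 0 ≤ c1) (hVsh : Vsh ≤ 20 / ℓ) (hVsh0 : 0 ≤ Vsh) (hE : E ≤ 8 * C₂ * x / ℓ ^ 3)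
    (hC₁ : 0 < C₁) (hCA : 0 ≤ CA) (hC₂ : 0 ≤ C₂) (hε : 0 < ε) (hx : 0 < x) (hℓ : 0 < ℓ) :
    B ≤ (960 * (1 + C₁) + 500 * CA * (1 + C₁) + 200 * C₂) * (ε * x / ℓ ^ 2 + x / ℓ ^ 3) := by
  set U : ℝ := 48 * ε * x / ℓ + 25 * CA * x / ℓ ^ 2 with hU
  have hU0 : 0 ≤ U := by positivity
  have hc2 : c2 - c1 ≤ U := by linarith
  have hexp : 1 + C₁ * Real.exp (-1) ≤ 1 + C₁ := by
    have h1 : Real.exp (-1) ≤ 1 := Real.exp_le_one_iff.2 (by norm_num)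
    have h2 := mul_le_mul_of_nonneg_left h1 hC₁.le
    linarith
  have hexp0 : 0 ≤ 1 + C₁ * Real.exp (-1) := by positivity
  have hm : (c2 - c1) * Vsh * (1 + C₁ * Real.exp (-1)) ≤ U * (20 / ℓ) * (1 + C₁) := by
    by_cases h0 : 0 ≤ c2 - c1
    · exact mul_le_mul (mul_le_mul hc2 hVsh hVsh0 hU0) hexp hexp0 (by positivity)
    · rw [not_le] at h0
      have : (c2 - c1) * Vsh * (1 + C₁ * Real.exp (-1)) ≤ 0 := by
        have := mul_nonpos_iff.2 (Or.inr ⟨h0.le, hVsh0⟩)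
        exact mul_nonpos_iff.2 (Or.inr ⟨this, hexp0⟩)
      have : 0 ≤ U * (20 / ℓ) * (1 + C₁) := by positivity
      linarith
  have e : U * (20 / ℓ) * (1 + C₁) + 8 * C₂ * x / ℓ ^ 3 =
      960 * (1 + C₁) * (ε * x / ℓ ^ 2) + (500 * CA * (1 + C₁) + 8 * C₂) * (x / ℓ ^ 3) := by
    rw [hU]; field_simp; ring
  have hfin : 960 * (1 + C₁) * (ε * x / ℓ ^ 2) + (500 * CA * (1 + C₁) + 8 * C₂) * (x / ℓ ^ 3) ≤
      (960 * (1 + C₁) + 500 * CA * (1 + C₁) + 200 * C₂) * (ε * x / ℓ ^ 2 + x / ℓ ^ 3) := by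
    rw [← sub_nonneg]
    have ex : (960 * (1 + C₁) + 500 * CA * (1 + C₁) + 200 * C₂) * (ε * x / ℓ ^ 2 + x / ℓ ^ 3) -
        (960 * (1 + C₁) * (ε * x / ℓ ^ 2) + (500 * CA * (1 + C₁) + 8 * C₂) * (x / ℓ ^ 3)) =
        960 * (1 + C₁) * (x / ℓ ^ 3) + 500 * CA * (1 + C₁) * (ε * x / ℓ ^ 2) +
          200 * C₂ * (ε * x / ℓ ^ 2) + 192 * C₂ * (x / ℓ ^ 3) := by ring
    rw [ex]; positivity
  linarith

/-- The arithmetic of `P5_count_le` over real variables. -/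
theorem P5_arith {B c2 c1 Vsh C₁ E main errA e η x ℓ CA C₂ : ℝ}
    (hB : B ≤ (c2 - c1) * Vsh * (1 + C₁ * Real.exp (-1)) + E)
    (hA : c2 - main ≤ errA) (hmain : main ≤ 4 * e * x / ℓ) (herrA : errA ≤ 100 * CA * x / ℓ ^ 2)
    (hc1 : 0 ≤ c1) (hVsh : Vsh ≤ 20 / ℓ) (hVsh0 : 0 ≤ Vsh) (hE : E ≤ 8 * C₂ * x / ℓ ^ 3)
    (hC₁ : 0 < C₁) (hCA : 0 ≤ CA) (he : e = η / (160 * (1 + C₁))) (hη : 0 < η)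
    (hx : 0 < x) (hℓ : 0 < ℓ) (hK : 2 * (2000 * CA * (1 + C₁) + 8 * C₂) ≤ η * ℓ) :
    B ≤ η * x / ℓ ^ 2 := by
  have he0 : 0 < e := by rw [he]; positivity
  set U : ℝ := 4 * e * x / ℓ + 100 * CA * x / ℓ ^ 2 with hU
  have hU0 : 0 ≤ U := by positivity
  have hc2 : c2 - c1 ≤ U := by linarith
  have hexp : 1 + C₁ * Real.exp (-1) ≤ 1 + C₁ := by
    have h1 : Real.exp (-1) ≤ 1 := Real.exp_le_one_iff.2 (by norm_num)
    have h2 := mul_le_mul_of_nonneg_left h1 hC₁.le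
    linarith
  have hexp0 : 0 ≤ 1 + C₁ * Real.exp (-1) := by positivity
  have hm : (c2 - c1) * Vsh * (1 + C₁ * Real.exp (-1)) ≤ U * (20 / ℓ) * (1 + C₁) := by
    by_cases h0 : 0 ≤ c2 - c1
    · exact mul_le_mul (mul_le_mul hc2 hVsh hVsh0 hU0) hexp hexp0 (by positivity)
    · rw [not_le] at h0
      have : (c2 - c1) * Vsh * (1 + C₁ * Real.exp (-1)) ≤ 0 := by
        have := mul_nonpos_iff.2 (Or.inr ⟨h0.le, hVsh0⟩)
        exact mul_nonpos_iff.2 (Or.inr ⟨this, hexp0⟩)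
      have : 0 ≤ U * (20 / ℓ) * (1 + C₁) := by positivity
      linarith
  have e1 : U * (20 / ℓ) * (1 + C₁) + 8 * C₂ * x / ℓ ^ 3 =
      η / 2 * (x / ℓ ^ 2) + (2000 * CA * (1 + C₁) + 8 * C₂) * (x / ℓ ^ 3) := by
    rw [hU, he]; field_simp; ring
  have h3 : (2000 * CA * (1 + C₁) + 8 * C₂) * (x / ℓ ^ 3) ≤ η / 2 * (x / ℓ ^ 2) := by
    have e2 : (2000 * CA * (1 + C₁) + 8 * C₂) * (x / ℓ ^ 3) =
        (2 * (2000 * CA * (1 + C₁) + 8 * C₂)) * (x / (2 * ℓ ^ 3)) := by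
      field_simp
    have e3 : η / 2 * (x / ℓ ^ 2) = (η * ℓ) * (x / (2 * ℓ ^ 3)) := by
      field_simp
    rw [e2, e3]
    exact mul_le_mul_of_nonneg_right hK (by positivity)
  have e4 : η * x / ℓ ^ 2 = η / 2 * (x / ℓ ^ 2) + η / 2 * (x / ℓ ^ 2) := by ring
  linarith

/-- `S + 1 ≤ 3q` whenever `S ≥ 0`, `S² ≤ 2x + 2`, `16 ≤ x ≤ q²`, `q > 0` (used with `S = ⌊√(2x+2)⌋`,
`q = x/y`). -/
theorem sqrt_arith {S q x : ℝ} (h1 : S ^ 2 ≤ 2 * x + 2) (hq : x ≤ q * q)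
    (hx16 : 16 ≤ x) (hq0 : 0 < q) : S + 1 ≤ 3 * q := by
  have hq4 : 4 ≤ q := by
    by_contra hlt
    rw [not_le] at hlt
    have : q * q < 16 := by nlinarith
    linarith
  by_contra hcon
  rw [not_le] at hcon
  have h2 : 3 * q - 1 < S := by linarith
  have h3 : (3 * q - 1) ^ 2 < S ^ 2 := pow_lt_pow_left₀ h2 (by linarith) two_ne_zero
  have h4 : S ^ 2 ≤ 2 * (q * q) + 2 := by linarith
  have hq16 : 4 * q ≤ q * q := by nlinarith
  have e : (3 * q - 1) ^ 2 = 9 * (q * q) - 6 * q + 1 := by ring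
  rw [e] at h3
  linarith

set_option maxHeartbeats 800000 in
/-- **The boundary strip on the host side.** There is an absolute `C` such that for `0 < ε ≤ 1/25`
and `x ≥ x₀(ε)`: the `x^{1/10}`-rough `m ∈ (x, 2x]` with `⌈x^{1/2−2ε}⌉ ≤ P⁻(m+2)` and `Ω(m+2) = 2`
number at most `C·(ε x/log²x + x/log³x)`. -/
theorem strip_count_le : ∃ C : ℝ, 0 < C ∧ ∀ ε : ℝ, 0 < ε → ε ≤ 1 / 25 → ∃ x₀ : ℕ, ∀ x : ℕ, x₀ ≤ x →
    (#((Finset.Ioc x (2 * x)).filter (fun m : ℕ =>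
        (∀ p ∈ m.primeFactors, (x : ℝ) ^ ((1 : ℝ) / 10) ≤ (p : ℝ)) ∧
        ⌈(x : ℝ) ^ ((1 : ℝ) / 2 - 2 * ε)⌉₊ ≤ (m + 2).minFac ∧ ArithmeticFunction.cardFactors (m + 2) = 1 + 1)) : ℝ) ≤
      C * (ε * (x : ℝ) / Real.log (x : ℝ) ^ 2 + (x : ℝ) / Real.log (x : ℝ) ^ 3) := by
  obtain ⟨C₁, C₂, hC₁, hC₂, hTC⟩ := twistedCell_sieve_le 1 3 3
  obtain ⟨CA, hCA, hAl⟩ := exists_abs_roughCell_sub_main_le 1 3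
  refine ⟨960 * (1 + C₁) + 500 * CA * (1 + C₁) + 200 * C₂, by positivity, fun ε hε hε25 => ?_⟩
  refine ⟨⌈Real.exp (max 200 (4 / ε))⌉₊, fun x hx => ?_⟩
  have hxE : Real.exp (max 200 (4 / ε)) ≤ (x : ℝ) := (Nat.le_ceil _).trans (by exact_mod_cast hx)
  have hx0 : (0 : ℝ) < x := (Real.exp_pos _).trans_le hxE
  set ℓ : ℝ := Real.log (x : ℝ) with hℓ
  have hℓM : max 200 (4 / ε) ≤ ℓ := by rw [hℓ, Real.le_log_iff_exp_le hx0]; exact hxE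
  have hℓ200 : 200 ≤ ℓ := (le_max_left _ _).trans hℓM
  have hℓε : 4 / ε ≤ ℓ := (le_max_right _ _).trans hℓM
  have hεℓ4 : 4 ≤ ε * ℓ := by have := (div_le_iff₀ hε).1 hℓε; linarith
  have hℓ0 : 0 < ℓ := by linarith
  have hx1 : (1 : ℝ) < x := by
    have h1 : Real.exp 0 < Real.exp ℓ := Real.exp_lt_exp.2 hℓ0
    rw [Real.exp_zero, hℓ, Real.exp_log hx0] at h1; exact h1
  have hxℓ : (x : ℝ) = Real.exp ℓ := by rw [hℓ, Real.exp_log hx0]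
  have hlog4 : Real.log 4 ≤ 2 := by
    have := Real.log_two_lt_d9
    rw [show (4 : ℝ) = 2 ^ 2 by norm_num, Real.log_pow]; push_cast; linarith
  -- parameters
  set w : ℝ := (x : ℝ) ^ ((1 : ℝ) / 10) with hw
  set D : ℝ := (x : ℝ) ^ ((1 : ℝ) / 2 - 2 * ε) with hD
  have hw0 : 0 < w := Real.rpow_pos_of_pos hx0 _
  have hD0 : 0 < D := Real.rpow_pos_of_pos hx0 _
  have hlogw : Real.log w = ℓ / 10 := by rw [hw, Real.log_rpow hx0]; ring
  have hwexp : w = Real.exp (ℓ / 10) := by rw [← hlogw, Real.exp_log hw0]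
  have hlogD : Real.log D = (1 / 2 - 2 * ε) * ℓ := by rw [hD, Real.log_rpow hx0]
  have hDexp : D = Real.exp ((1 / 2 - 2 * ε) * ℓ) := by rw [← hlogD, Real.exp_log hD0]
  have hw2 : 2 < w := by
    rw [hwexp]
    have h1 : Real.exp 1 ≤ Real.exp (ℓ / 10) := Real.exp_le_exp.2 (by linarith)
    have h2 : (2 : ℝ) < Real.exp 1 := by have := Real.exp_one_gt_d9; linarith
    linarith
  have hwD : w ≤ D := by
    rw [hwexp, hDexp]; refine Real.exp_le_exp.2 ?_
    have h := mul_nonneg (show (0:ℝ) ≤ 2 / 5 - 2 * ε by linarith) hℓ0.le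
    linarith
  have hDx : D ≤ (x : ℝ) + 2 := by
    have : D ≤ (x : ℝ) := by
      rw [hD]; calc (x : ℝ) ^ ((1 : ℝ) / 2 - 2 * ε) ≤ (x : ℝ) ^ (1 : ℝ) :=
            Real.rpow_le_rpow_of_exponent_le hx1.le (by linarith)
        _ = x := Real.rpow_one _
    linarith
  have hlogX2 : Real.log (2 * (x : ℝ) + 2) ≤ Real.log 4 + ℓ := by
    rw [hℓ, ← Real.log_mul (by norm_num) hx0.ne']; exact Real.log_le_log (by positivity) (by linarith)
  have hlogX2' : ℓ ≤ Real.log (2 * (x : ℝ) + 2) := Real.log_le_log hx0 (by linarith)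
  have hlogX1' : ℓ ≤ Real.log ((x : ℝ) + 2) := Real.log_le_log hx0 (by linarith)
  have hlog3 : Real.log (2 * (x : ℝ) + 2) ≤ (3 : ℕ) * Real.log D := by
    rw [hlogD]; push_cast
    have h := mul_le_mul_of_nonneg_right (show (21:ℝ) / 50 ≤ 1 / 2 - 2 * ε by linarith) hℓ0.le
    linarith
  have hw4 : w ≤ ((x : ℝ) + 2) ^ ((1 : ℝ) / 4) := by
    have h1 : w ≤ (x : ℝ) ^ ((1 : ℝ) / 4) := by
      rw [hw]; exact Real.rpow_le_rpow_of_exponent_le hx1.le (by norm_num)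
    exact h1.trans (Real.rpow_le_rpow hx0.le (by linarith) (by norm_num))
  -- the sieve step at level `L = w`
  have hS := hTC x w w D hw2 le_rfl hwD hDx hlog3 hw4
  rw [show Real.log w / Real.log w = 1 from div_self (by rw [hlogw]; positivity)] at hS
  -- `V_sh(w) ≤ 20/ℓ`
  have hVsh : ∏ p ∈ (Finset.range ⌈w⌉₊).filter (fun p : ℕ => p.Prime ∧ p ≠ 2), (1 - 1 / ((p : ℝ) - 1)) ≤
      20 / ℓ := by
    refine (Vsh_le_div_log hw2).trans (le_of_eq ?_)
    rw [hlogw]; field_simp; norm_num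
  have hVsh0 : 0 ≤ ∏ p ∈ (Finset.range ⌈w⌉₊).filter (fun p : ℕ => p.Prime ∧ p ≠ 2),
      (1 - 1 / ((p : ℝ) - 1)) :=
    Finset.prod_nonneg fun p hp => by
      obtain ⟨-, hpr, hne⟩ := Finset.mem_filter.1 hp
      have h3 : (3 : ℝ) ≤ p := by exact_mod_cast (by have := hpr.two_le; omega : 3 ≤ p)
      rw [sub_nonneg, div_le_one (by linarith)]; linarith
  -- Alladi for the cell `Ω = 2` above `D` at height `2x+2`
  have hD2 : 2 ≤ D := by linarith
  have hX2 : D ≤ ((2 * x + 2 : ℕ) : ℝ) := by push_cast; linarith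
  have hlogk : Real.log ((2 * x + 2 : ℕ) : ℝ) ≤ (3 : ℕ) * Real.log D := by push_cast; exact hlog3
  have hA2 := hAl ((2 * x + 2 : ℕ) : ℝ) D hD2 hX2 hlogk
  rw [Nat.floor_natCast] at hA2
  simp only [show (1 : ℕ) ≠ 0 from one_ne_zero, if_false, sub_zero] at hA2
  obtain ⟨u, hu⟩ : ∃ u : ℝ, u = Real.log ((2 * x + 2 : ℕ) : ℝ) / Real.log D := ⟨_, rfl⟩
  rw [← hu] at hA2
  have hα0 : (0 : ℝ) < 1 / 2 - 2 * ε := by linarith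
  have hlogDpos : 0 < Real.log D := by rw [hlogD]; positivity
  have hu2 : 2 ≤ u := by
    rw [hu, le_div_iff₀ hlogDpos, hlogD]
    have h0 : 0 ≤ ε * ℓ := by positivity
    have h1 : ℓ ≤ Real.log ((2 * x + 2 : ℕ) : ℝ) := by push_cast; exact hlogX2'
    linarith
  have hu1 : u - 1 ≤ 1 + 12 * ε := by
    have h1 : u ≤ (Real.log 4 + ℓ) / ((1 / 2 - 2 * ε) * ℓ) := by
      rw [hu, hlogD]; push_cast
      exact div_le_div_of_nonneg_right hlogX2 (by positivity)
    have h2 : (Real.log 4 + ℓ) / ((1 / 2 - 2 * ε) * ℓ) ≤ 2 + 12 * ε := by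
      rw [div_le_iff₀ (by positivity)]
      have h12 : (1 : ℝ) / 2 ≤ 1 - 12 * ε := by linarith
      have hprod : 4 * (1 / 2 : ℝ) ≤ (ε * ℓ) * (1 - 12 * ε) := mul_le_mul hεℓ4 h12 (by norm_num) (by positivity)
      have e : (2 + 12 * ε) * ((1 / 2 - 2 * ε) * ℓ) = ℓ + 2 * ((ε * ℓ) * (1 - 12 * ε)) := by ring
      rw [e]; linarith
    linarith
  have hI2 : roughCellDensity (1 + 1) u ≤ 12 * ε := by
    rw [show (1 : ℕ) + 1 = 2 from rfl, roughCellDensity_two_of_two_le hu2]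
    have := Real.log_le_sub_one_of_pos (show 0 < u - 1 by linarith)
    linarith
  have hX4 : ((2 * x + 2 : ℕ) : ℝ) ≤ 4 * x := by push_cast; linarith
  have hX4eq : ((2 * x + 2 : ℕ) : ℝ) = 2 * (x : ℝ) + 2 := by push_cast; ring
  have h := (abs_le.1 hA2).2
  have hlX0 : 0 < Real.log ((2 * x + 2 : ℕ) : ℝ) := by push_cast; linarith
  have hmain : ((2 * x + 2 : ℕ) : ℝ) * roughCellDensity (1 + 1) u / Real.log ((2 * x + 2 : ℕ) : ℝ) ≤
      48 * ε * x / ℓ := by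
    have hnum : ((2 * x + 2 : ℕ) : ℝ) * roughCellDensity (1 + 1) u ≤ (4 * x) * (12 * ε) :=
      mul_le_mul hX4 hI2 (roughCellDensity_nonneg _ _) (by positivity)
    calc _ ≤ (4 * x) * (12 * ε) / Real.log ((2 * x + 2 : ℕ) : ℝ) := div_le_div_of_nonneg_right hnum hlX0.le
      _ ≤ (4 * x) * (12 * ε) / ℓ := div_le_div_of_nonneg_left (by positivity) hℓ0 (by push_cast; exact hlogX2')
      _ = 48 * ε * x / ℓ := by ring
  have herr : CA * ((2 * x + 2 : ℕ) : ℝ) / Real.log D ^ 2 ≤ 25 * CA * x / ℓ ^ 2 := by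
    rw [hlogD, hX4eq]
    have hsq : (4 / 25 : ℝ) * ℓ ^ 2 ≤ ((1 / 2 - 2 * ε) * ℓ) ^ 2 := by
      rw [mul_pow]
      exact mul_le_mul_of_nonneg_right (by nlinarith) (sq_nonneg ℓ)
    have hpos : (0 : ℝ) < ((1 / 2 - 2 * ε) * ℓ) ^ 2 := by positivity
    rw [div_le_div_iff₀ hpos (by positivity)]
    calc CA * (2 * (x : ℝ) + 2) * ℓ ^ 2 ≤ CA * (4 * x) * ℓ ^ 2 := by
          have : CA * (2 * (x : ℝ) + 2) ≤ CA * (4 * x) := mul_le_mul_of_nonneg_left (by linarith) hCA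
          exact mul_le_mul_of_nonneg_right this (sq_nonneg ℓ)
      _ = 25 * CA * x * ((4 / 25 : ℝ) * ℓ ^ 2) := by ring
      _ ≤ 25 * CA * x * ((1 / 2 - 2 * ε) * ℓ) ^ 2 := mul_le_mul_of_nonneg_left hsq (by positivity)
  -- the BV error terms with `A = 3`
  have hl2pos : 0 < Real.log (2 * (x : ℝ) + 2) := by linarith
  have hl1pos : 0 < Real.log ((x : ℝ) + 2) := by linarith
  have hBV : C₂ * (2 * (x : ℝ) + 2) / Real.log (2 * (x : ℝ) + 2) ^ (3 : ℝ) +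
      C₂ * ((x : ℝ) + 2) / Real.log ((x : ℝ) + 2) ^ (3 : ℝ) ≤ 8 * C₂ * x / ℓ ^ 3 := by
    have e3 : ∀ r : ℝ, r ^ (3 : ℝ) = r ^ 3 := fun r => by
      rw [← Real.rpow_natCast]; norm_num
    rw [e3, e3]
    have h1 : C₂ * (2 * (x : ℝ) + 2) / Real.log (2 * (x : ℝ) + 2) ^ 3 ≤ C₂ * (4 * x) / ℓ ^ 3 := by
      calc _ ≤ C₂ * (4 * x) / Real.log (2 * (x : ℝ) + 2) ^ 3 :=
            div_le_div_of_nonneg_right (mul_le_mul_of_nonneg_left (by linarith) hC₂) (pow_pos hl2pos 3).le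
        _ ≤ C₂ * (4 * x) / ℓ ^ 3 :=
            div_le_div_of_nonneg_left (by positivity) (by positivity) (pow_le_pow_left₀ hℓ0.le hlogX2' 3)
    have h2 : C₂ * ((x : ℝ) + 2) / Real.log ((x : ℝ) + 2) ^ 3 ≤ C₂ * (4 * x) / ℓ ^ 3 := by
      calc _ ≤ C₂ * (4 * x) / Real.log ((x : ℝ) + 2) ^ 3 :=
            div_le_div_of_nonneg_right (mul_le_mul_of_nonneg_left (by linarith) hC₂) (pow_pos hl1pos 3).le
        _ ≤ C₂ * (4 * x) / ℓ ^ 3 :=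
            div_le_div_of_nonneg_left (by positivity) (by positivity) (pow_le_pow_left₀ hℓ0.le hlogX1' 3)
    have e' : 8 * C₂ * x / ℓ ^ 3 = C₂ * (4 * x) / ℓ ^ 3 + C₂ * (4 * x) / ℓ ^ 3 := by ring
    rw [e']; exact add_le_add h1 h2
  exact strip_arith hS h hmain herr (Nat.cast_nonneg _) hVsh hVsh0 hBV hC₁ hCA hC₂ hε hx0 hℓ0

end Summit.Parity.GeneralizedHardyLittlewood.Theorems.ParityLeakOneFifth
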